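import Literature.Geometry.Lorentzian.CoordWeightedPoincareVectorBoundary
import Literature.Geometry.Lorentzian.CoordWeightedVectorBoundary
import HarnessLib

/-!
# The weighted Hessian estimate at a boundary (Chruściel–Delay 2003, proof of Thm. 5.9)

Topic `Literature/Geometry/Lorentzian`, coordinate tensor calculus `MetricCoord` (Riemannian metric
components `G` on an open set `V`). Everything here is PROVED; no definition and no statement of
`Prop` type is introduced.

The lapse half of the first step of the proof of Thm. 5.9 of Chruściel–Delay (Mém. SMF 94 (2003),
p. 29): "Applying Proposition C.4 with `u := x²∇N` … we find that
`‖x⁴∇∇N‖ ≥ C₁‖x²∇N‖`" in the exponentially weighted norms near the boundary. With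
`Q(L) = tr_G G(L·, L·)` (`mtrAt G x ((G x).bilinearComp L L)`, the square norm of an
endomorphism) and `v = −s/x + t log x`:

* `IsMetricOn.mtrAt_bilinearComp_add_le`, `_smul_left`, `_smulRight`, `_sharp_hessAt` — pointwise
  algebra of `Q`: `Q(L₁ + L₂) ≤ 2Q(L₁) + 2Q(L₂)`, `Q(cL) = c²Q(L)`, `Q(θ⊗w) = |θ|²|w|²`,
  `Q(♯Hess N) = |Hess N|²`;
* `IsMetricOn.covDAt_sqSmulGrad` — `∇(x²∇N) = x² ♯Hess N + 2x dx ⊗ ∇N`;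
  `IsMetricOn.mtrAt_covDAt_sqSmulGrad_le` — `|∇(x²∇N)|² ≤ 2x⁴|Hess N|² + 8x²|dx|²|∇N|²`;
* **`IsMetricOn.integral_weightedHessian_boundary`** — for `m ≤ |∇x|²`, `|Δx| ≤ M` on
  `{0 < x < x₁}` and `ε < s²` there is `x₀ > 0` with
  `(s² − ε) ∫ √det g · e^{2v}|∇x|²|∇N|² dμ ≤ 4 ∫ √det g · e^{2v} x⁴ |Hess N|² dμ`
  for every `N` smooth on `V` with compact support in `{0 < x < x₀}` (Prop. C.4 for the vector
  field `x²∇N`, `IsMetricOn.integral_weightedPoincareVector_boundary`, and absorption of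
  `8x²|dx|²|∇N|²`).

## References

* P. T. Chruściel, E. Delay, Mém. Soc. Math. Fr. 94 (2003), proof of Thm. 5.9 (p. 29); App. C,
  Prop. C.4. [ChruscielDelay2003]
* B. O'Neill, *Semi-Riemannian geometry*, 1983, Ch. 2, Lemma 2.25; Ch. 3, Lemma 3.49.
  [ONeill1983]
-/

noncomputable section

set_option maxSynthPendingDepth 3

open Set Filter Module Function MeasureTheory
open scoped Topology ContDiff

namespace Literature.Geometry.Lorentzian

namespace MetricCoord

variable {E : Type*} [NormedAddCommGroup E] [NormedSpace ℝ E] [FiniteDimensional ℝ E]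
  [CompleteSpace E] {ι : Type*} [Fintype ι] [DecidableEq ι] (b : Basis ι ℝ E)
  {G : E → E →L[ℝ] E →L[ℝ] ℝ} {V : Set E} {x : E} {N : E → ℝ}

/-! ### Pointwise algebra of `Q(L) = tr_G G(L·, L·)` -/

omit [CompleteSpace E] [Fintype ι] [DecidableEq ι] in
/-- **`Q(L₁ + L₂) ≤ 2Q(L₁) + 2Q(L₂)`** at a positive definite point (`G(a+b,a+b) ≤ 2G(a,a) + 2G(b,b)`
termwise in an orthonormal frame). [cite: ONeill1983, Ch. 2, Lemma 2.25] -/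
theorem IsMetricOn.mtrAt_bilinearComp_add_le (hG : IsMetricOn G V) (hx : x ∈ V)
    (hpos : ∀ e : E, e ≠ 0 → 0 < G x e e) (L₁ L₂ : E →L[ℝ] E) :
    mtrAt G x ((G x).bilinearComp (L₁ + L₂) (L₁ + L₂)) ≤
      2 * mtrAt G x ((G x).bilinearComp L₁ L₁) + 2 * mtrAt G x ((G x).bilinearComp L₂ L₂) := by
  have hi := hG.isInvertible x hx
  have hs := hG.symm x hx
  obtain ⟨e, he⟩ := exists_orthonormal_basis hs hpos
  rw [mtrAt_eq_sum_frame e he hi, mtrAt_eq_sum_frame e he hi, mtrAt_eq_sum_frame e he hi,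
    Finset.mul_sum, Finset.mul_sum, ← Finset.sum_add_distrib]
  refine Finset.sum_le_sum fun c _ ↦ ?_
  have h0 : 0 ≤ G x (L₁ (e c) - L₂ (e c)) (L₁ (e c) - L₂ (e c)) := by
    by_cases hz : L₁ (e c) - L₂ (e c) = 0
    · simp [hz]
    · exact (hpos _ hz).le
  simp only [ContinuousLinearMap.bilinearComp_apply, _root_.add_apply, map_add, map_sub,
    _root_.sub_apply, hs (L₂ (e c)) (L₁ (e c))] at h0 ⊢
  linarith

omit [CompleteSpace E] [Fintype ι] [DecidableEq ι] in
/-- **`Q(cL) = c² Q(L)`.** [cite: ONeill1983, Ch. 2, Lemma 2.25] -/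
theorem IsMetricOn.mtrAt_bilinearComp_smul_left (hG : IsMetricOn G V) (hx : x ∈ V)
    (hpos : ∀ e : E, e ≠ 0 → 0 < G x e e) (c : ℝ) (L : E →L[ℝ] E) :
    mtrAt G x ((G x).bilinearComp (c • L) (c • L)) = c ^ 2 * mtrAt G x ((G x).bilinearComp L L) := by
  have hi := hG.isInvertible x hx
  obtain ⟨e, he⟩ := exists_orthonormal_basis (hG.symm x hx) hpos
  rw [mtrAt_eq_sum_frame e he hi, mtrAt_eq_sum_frame e he hi, Finset.mul_sum]
  refine Finset.sum_congr rfl fun i _ ↦ ?_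
  simp only [ContinuousLinearMap.bilinearComp_apply, _root_.smul_apply, map_smul, smul_eq_mul]
  ring

omit [CompleteSpace E] [Fintype ι] [DecidableEq ι] in
/-- **`Q(θ ⊗ w) = θ(♯θ) G(w,w)`.** [cite: ONeill1983, Ch. 2, Lemma 2.25] -/
theorem IsMetricOn.mtrAt_bilinearComp_smulRight (hG : IsMetricOn G V) (hx : x ∈ V)
    (hpos : ∀ e : E, e ≠ 0 → 0 < G x e e) (θ : E →L[ℝ] ℝ) (w : E) :
    mtrAt G x ((G x).bilinearComp (θ.smulRight w) (θ.smulRight w)) = θ (sharpAt G x θ) * G x w w := by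
  have h := hG.mtrAt_bilinearComp_add_smulRight hx hpos 0 θ w
  have h0 : mtrAt G x ((G x).bilinearComp (0 : E →L[ℝ] E) (0 : E →L[ℝ] E)) = 0 := by
    have hi := hG.isInvertible x hx
    obtain ⟨e, he⟩ := exists_orthonormal_basis (hG.symm x hx) hpos
    rw [mtrAt_eq_sum_frame e he hi]
    simp
  simpa only [zero_add, h0, _root_.zero_apply, map_zero, mul_zero] using h

omit [CompleteSpace E] [Fintype ι] [DecidableEq ι] in
/-- **`Q(♯Hess N) = |Hess N|²_G`** (`Q` of the endomorphism `X ↦ ♯Hess N(X,·)`; `|·|²_G = normSqAt`).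
[cite: ONeill1983, Ch. 3, Lemma 3.49] -/
theorem IsMetricOn.mtrAt_bilinearComp_sharp_comp (hG : IsMetricOn G V) (hx : x ∈ V)
    (hpos : ∀ e : E, e ≠ 0 → 0 < G x e e) (H : E →L[ℝ] E →L[ℝ] ℝ) :
    mtrAt G x ((G x).bilinearComp ((sharpAt G x).comp H) ((sharpAt G x).comp H)) =
      normSqAt G x H := by
  have hi := hG.isInvertible x hx
  have hs := hG.symm x hx
  obtain ⟨e, he⟩ := exists_orthonormal_basis hs hpos
  rw [mtrAt_eq_sum_frame e he hi, normSqAt_eq_sum_frame e he hi hs]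
  refine Finset.sum_congr rfl fun i _ ↦ ?_
  rw [ContinuousLinearMap.bilinearComp_apply, ContinuousLinearMap.comp_apply, apply_sharpAt_apply hi,
    apply_sharpAt_eq_sum_frame e he hi hs]
  exact Finset.sum_congr rfl fun c _ ↦ by rw [sq]

/-! ### `∇(x²∇N)` -/

omit [FiniteDimensional ℝ E] [Fintype ι] [DecidableEq ι] in
/-- **`∇_X(x²∇N) = x² ♯Hess N(X,·) + 2x dx(X) ∇N`** for `x, N` smooth on `V`.
[cite: ONeill1983, Ch. 3, Lemma 3.49] -/
theorem IsMetricOn.covDAt_sqSmulGrad (hG : IsMetricOn G V) (hx : x ∈ V) {xf : E → ℝ}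
    (hxf : ContDiffOn ℝ ∞ xf V) (hN : ContDiffOn ℝ ∞ N V) :
    covDAt G (fun y ↦ (xf y ^ 2) • sharpAt G y (fderiv ℝ N y)) x =
      (xf x ^ 2) • (sharpAt G x).comp (hessAt G N x)
        + ((2 * xf x) • fderiv ℝ xf x).smulRight (sharpAt G x (fderiv ℝ N x)) := by
  have hxs : V ∈ 𝓝 x := hG.mem_nhds hx
  have hxd : DifferentiableAt ℝ xf x := ((hxf x hx).contDiffAt hxs).differentiableAt (by simp)
  have hZs : ContDiffOn ℝ ∞ (fun y ↦ sharpAt G y (fderiv ℝ N y)) V :=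
    hG.contDiffOn_sharpAt.clm_apply (hN.fderiv_of_isOpen hG.isOpen (by simp))
  have hZd : DifferentiableAt ℝ (fun y ↦ sharpAt G y (fderiv ℝ N y)) x :=
    ((hZs x hx).contDiffAt hxs).differentiableAt (by simp)
  have hsq : HasFDerivAt (fun y ↦ xf y ^ 2) ((2 * xf x) • fderiv ℝ xf x) x := by
    have h := hxd.hasFDerivAt.pow 2
    simp only [Nat.add_one_sub_one, pow_one, nsmul_eq_mul, Nat.cast_ofNat] at h
    exact h
  rw [covDAt_smul hsq.differentiableAt hZd, hsq.fderiv]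
  ext X
  simp only [_root_.add_apply, _root_.smul_apply, ContinuousLinearMap.smulRight_apply,
    ContinuousLinearMap.comp_apply, hG.covDAt_grad_apply hx hN X]

omit [Fintype ι] [DecidableEq ι] in
/-- **`|∇(x²∇N)|² ≤ 2x⁴|Hess N|² + 8x²|dx|²|∇N|²`** at a positive definite point.
[cite: ChruscielDelay2003, Thm. 5.9 (proof)] -/
theorem IsMetricOn.mtrAt_covDAt_sqSmulGrad_le (hG : IsMetricOn G V) (hx : x ∈ V)
    (hpos : ∀ e : E, e ≠ 0 → 0 < G x e e) {xf : E → ℝ}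
    (hxf : ContDiffOn ℝ ∞ xf V) (hN : ContDiffOn ℝ ∞ N V) :
    mtrAt G x ((G x).bilinearComp (covDAt G (fun y ↦ (xf y ^ 2) • sharpAt G y (fderiv ℝ N y)) x)
        (covDAt G (fun y ↦ (xf y ^ 2) • sharpAt G y (fderiv ℝ N y)) x)) ≤
      2 * (xf x ^ 4 * normSqAt G x (hessAt G N x))
        + 8 * (xf x ^ 2 * gradSqAt G xf x * gradSqAt G N x) := by
  have hi := hG.isInvertible x hx
  rw [hG.covDAt_sqSmulGrad hx hxf hN]
  refine (hG.mtrAt_bilinearComp_add_le hx hpos _ _).trans (le_of_eq ?_)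
  rw [hG.mtrAt_bilinearComp_smul_left hx hpos, hG.mtrAt_bilinearComp_sharp_comp hx hpos,
    hG.mtrAt_bilinearComp_smulRight hx hpos, map_smul, _root_.smul_apply, map_smul, smul_eq_mul,
    smul_eq_mul, ← gradSqAt_apply, apply_sharpAt_apply hi, ← gradSqAt_apply]
  ring

/-! ### Integrability bookkeeping -/

section Integral

variable [MeasurableSpace E] [BorelSpace E] (μ : Measure E) [μ.IsAddHaarMeasure]

omit [FiniteDimensional ℝ E] [CompleteSpace E] in
/-- **Integrability bookkeeping**: for Riemannian metric components `G` on `V`, a compact set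
`S ⊆ V` and `k` smooth on `V` vanishing off `S`, `√det g · k` is integrable. [folklore] -/
theorem IsMetricOn.integrable_sqrtDetGram_mul_of_subset (hG : IsMetricOn G V)
    (hpos : ∀ y ∈ V, ∀ e : E, e ≠ 0 → 0 < G y e e) {S : Set E} (hS : IsCompact S)
    (hSc : IsClosed S) (hSV : S ⊆ V) {k : E → ℝ} (hk : ContDiffOn ℝ ∞ k V)
    (hk0 : ∀ z ∉ S, k z = 0) : Integrable (fun z ↦ sqrtDetGram G b z * k z) μ := by
  have hsg : ContDiffOn ℝ ∞ (sqrtDetGram G b) V := hG.contDiffOn_sqrtDetGram b hpos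
  have hc : Continuous fun z ↦ sqrtDetGram G b z * k z := by
    refine continuous_iff_continuousAt.2 fun y ↦ ?_
    by_cases hy : y ∈ S
    · have hyV := hSV hy
      exact ((hsg.continuousOn.continuousWithinAt hyV).continuousAt (hG.mem_nhds hyV)).mul
        ((hk.continuousOn.continuousWithinAt hyV).continuousAt (hG.mem_nhds hyV))
    · have hev : (fun z ↦ sqrtDetGram G b z * k z) =ᶠ[𝓝 y] fun _ ↦ 0 := by
        filter_upwards [hSc.isOpen_compl.mem_nhds hy] with z hz
        rw [hk0 z hz, mul_zero]
      exact (continuousAt_const.congr_of_eventuallyEq hev :)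
  refine hc.integrable_of_hasCompactSupport (HasCompactSupport.of_support_subset_isCompact hS ?_)
  intro y hy
  by_contra hyS
  exact hy (show sqrtDetGram G b y * k y = 0 by rw [hk0 y hyS, mul_zero])

/-! ### The weighted Hessian estimate -/

/-- **The weighted Hessian estimate at a boundary** (Chruściel–Delay 2003, proof of Thm. 5.9,
"`‖x⁴∇∇N‖ ≥ C₁‖x²∇N‖`"), in coordinates. Let `G` be Riemannian metric components on `V` and `x`
a smooth function on `V` with `m ≤ |∇x|²` and `|Δx| ≤ M` on `{0 < x < x₁}` (`m > 0`); let
`ε < s²`. Then there is `x₀ > 0` such that for every `N` smooth on `V` with compact support inside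
`{0 < x < x₀}`, with `v = −s/x + t log x`,
`(s² − ε) ∫ √det g · e^{2v} |∇x|² |∇N|² dμ ≤ 4 ∫ √det g · e^{2v} x⁴ |Hess N|²_G dμ`
(Prop. C.4 for the vector field `x²∇N`, whose covariant derivative satisfies
`|∇(x²∇N)|² ≤ 2x⁴|Hess N|² + 8x²|dx|²|∇N|²`, and absorption of the last term for `8x₀ ≤ (s²−ε)/2`).
[cite: ChruscielDelay2003, Thm. 5.9 (proof), App. C, Prop. C.4] -/
theorem IsMetricOn.integral_weightedHessian_boundary (hG : IsMetricOn G V)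
    (hpos : ∀ y ∈ V, ∀ e : E, e ≠ 0 → 0 < G y e e) {xf : E → ℝ} (hxf : ContDiffOn ℝ ∞ xf V)
    {x₁ m M : ℝ} (hx₁ : 0 < x₁) (hm : 0 < m) (hM : 0 ≤ M)
    (hgrad : ∀ y ∈ V, 0 < xf y → xf y < x₁ → m ≤ gradSqAt G xf y)
    (hlap : ∀ y ∈ V, 0 < xf y → xf y < x₁ → |lapAt G xf y| ≤ M) (s t : ℝ) {ε : ℝ} (hε : 0 < ε)
    (hsε : ε < s ^ 2) :
    ∃ x₀ : ℝ, 0 < x₀ ∧ ∀ N : E → ℝ, ContDiffOn ℝ ∞ N V → HasCompactSupport N →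
      tsupport N ⊆ {y ∈ V | 0 < xf y ∧ xf y < x₀} →
      (s ^ 2 - ε) * ∫ y, sqrtDetGram G b y *
          (Real.exp (2 * (-s / xf y + t * Real.log (xf y))) * gradSqAt G xf y * gradSqAt G N y) ∂μ ≤
        4 * ∫ y, sqrtDetGram G b y *
          (Real.exp (2 * (-s / xf y + t * Real.log (xf y))) * xf y ^ 4
            * normSqAt G y (hessAt G N y)) ∂μ := by
  obtain ⟨x₀', hx₀', hC4⟩ :=
    hG.integral_weightedPoincareVector_boundary b μ hpos hxf hx₁ hm hM hgrad hlap s t hε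
  set x₀ : ℝ := min (min x₀' 1) ((s ^ 2 - ε) / 16) with hx₀
  have hsε' : 0 < s ^ 2 - ε := sub_pos.2 hsε
  have hx₀pos : 0 < x₀ := by positivity
  have hx₀le : x₀ ≤ x₀' := (min_le_left _ _).trans (min_le_left _ _)
  have hx₀1 : x₀ ≤ 1 := (min_le_left _ _).trans (min_le_right _ _)
  have hx₀s : x₀ ≤ (s ^ 2 - ε) / 16 := min_le_right _ _
  refine ⟨x₀, hx₀pos, fun N hN hsupp hNS ↦ ?_⟩
  -- the collar
  set V' : Set E := {y ∈ V | 0 < xf y} with hV'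
  have hV'o : IsOpen V' := hxf.continuousOn.isOpen_inter_preimage hG.isOpen isOpen_Ioi
  have hV'V : V' ⊆ V := fun y hy ↦ hy.1
  have hG' : IsMetricOn G V' :=
    ⟨hV'o, hG.contDiffOn.mono hV'V, fun y hy ↦ hG.symm y (hV'V hy), fun y hy ↦ hG.isInvertible y (hV'V hy)⟩
  have hpos' : ∀ y ∈ V', ∀ e : E, e ≠ 0 → 0 < G y e e := fun y hy ↦ hpos y hy.1
  have hNV' : tsupport N ⊆ V' := fun y hy ↦ ⟨(hNS hy).1, (hNS hy).2.1⟩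
  have hN' : ContDiffOn ℝ ∞ N V' := hN.mono hV'V
  have hxf' : ContDiffOn ℝ ∞ xf V' := hxf.mono hV'V
  have hne : ∀ y ∈ V', xf y ≠ 0 := fun y hy ↦ hy.2.ne'
  -- the field `U = x² ∇N`
  set U : E → E := fun y ↦ (xf y ^ 2) • sharpAt G y (fderiv ℝ N y) with hUdef
  have hN0 : ∀ y ∉ tsupport N, N y = 0 ∧ fderiv ℝ N y = 0 := fun y hy ↦
    (eventually_eq_zero_and_fderiv_eq_zero hy).self_of_nhds
  have hU0 : ∀ y ∉ tsupport N, U y = 0 := fun y hy ↦ by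
    simp only [hUdef, (hN0 y hy).2, map_zero, smul_zero]
  have hUs : ContDiffOn ℝ ∞ U V :=
    (hxf.pow 2).smul (hG.contDiffOn_sharpAt.clm_apply (hN.fderiv_of_isOpen hG.isOpen (by simp)))
  have htU : tsupport U ⊆ tsupport N :=
    closure_minimal (fun y hy ↦ by by_contra h; exact hy (hU0 y h)) (isClosed_tsupport N)
  have hUsupp : HasCompactSupport U := hsupp.mono' (subset_tsupport _ |>.trans htU)
  have hUS : tsupport U ⊆ {y ∈ V | 0 < xf y ∧ xf y < x₀'} := fun y hy ↦
    ⟨(hNS (htU hy)).1, (hNS (htU hy)).2.1, (hNS (htU hy)).2.2.trans_le hx₀le⟩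
  have hC := hC4 U hUs hUsupp hUS
  -- notation for the weight and the integrands
  set wt : E → ℝ := fun y ↦ Real.exp (2 * (-s / xf y + t * Real.log (xf y))) with hwtdef
  set I₀ : E → ℝ := fun y ↦ wt y * gradSqAt G xf y * gradSqAt G N y with hI₀def
  set H₀ : E → ℝ := fun y ↦ wt y * xf y ^ 4 * normSqAt G y (hessAt G N y) with hH₀def
  set Q₀ : E → ℝ := fun y ↦ wt y * mtrAt G y ((G y).bilinearComp (covDAt G U y) (covDAt G U y))
    with hQ₀def
  -- the left-hand side of Prop. C.4 for `U` is `∫ wt |∇x|² |∇N|²`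
  have hlhs : ∀ y, wt y * (gradSqAt G xf y / xf y ^ 4) * G y (U y) (U y) = I₀ y := by
    intro y
    by_cases hy : y ∈ tsupport N
    · have hyV' := hNV' hy
      have hi := hG.isInvertible y hyV'.1
      have hx0 : xf y ≠ 0 := hyV'.2.ne'
      simp only [hUdef, hI₀def, map_smul, _root_.smul_apply, smul_eq_mul, apply_sharpAt_apply hi,
        ← gradSqAt_apply]
      field_simp
    · simp only [hU0 y hy, hI₀def, (hN0 y hy).2, map_zero, mul_zero, gradSqAt_apply]
  -- the three integrands vanish off the support of `N`
  have hI0 : ∀ y ∉ tsupport N, I₀ y = 0 := fun y hy ↦ by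
    simp only [hI₀def, (hN0 y hy).2, gradSqAt_apply, map_zero, mul_zero]
  have hH0 : ∀ y ∉ tsupport N, H₀ y = 0 := fun y hy ↦ by
    have hNy : N =ᶠ[𝓝 y] fun _ ↦ 0 := notMem_tsupport_iff_eventuallyEq.mp hy
    have hh : hessAt G N y = 0 := by
      rw [hessAt_congr_of_eventuallyEq G hNy]
      ext Y Z
      simp [hessAt_apply]
    simp [hH₀def, hh, normSqAt_eq_traceCLM]
  have hQ0 : ∀ y ∉ tsupport N, Q₀ y = 0 := fun y hy ↦ by
    have hUy : U =ᶠ[𝓝 y] fun _ ↦ 0 :=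
      notMem_tsupport_iff_eventuallyEq.mp fun h ↦ hy (htU h)
    have hcov : covDAt G U y = 0 := by
      ext e
      simp only [covDAt_apply, hUy.self_of_nhds, hUy.fderiv_eq, fderiv_fun_const, map_zero,
        _root_.zero_apply, add_zero, Pi.zero_apply]
    simp only [hQ₀def, hcov]
    rw [mtrAt_eq_sum b]; simp
  -- pointwise bound of the right-hand side
  have hrhs : ∀ y, Q₀ y ≤ 2 * H₀ y + 8 * x₀ * I₀ y := by
    intro y
    by_cases hy : y ∈ tsupport N
    · obtain ⟨hyV, hx, hxx₀⟩ := hNS hy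
      have hwt : 0 ≤ wt y := (Real.exp_pos _).le
      have hb := hG.mtrAt_covDAt_sqSmulGrad_le hyV (hpos y hyV) hxf hN
      have hi := hG.isInvertible y hyV
      have hgs : ∀ φ : E →L[ℝ] ℝ, 0 ≤ φ (sharpAt G y φ) := by
        intro φ
        rw [← apply_sharpAt_apply hi φ]
        by_cases hz : sharpAt G y φ = 0
        · simp [hz]
        · exact (hpos y hyV _ hz).le
      have hg0 : 0 ≤ gradSqAt G xf y * gradSqAt G N y := by
        rw [gradSqAt_apply, gradSqAt_apply]
        exact mul_nonneg (hgs _) (hgs _)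
      have hx2 : xf y ^ 2 ≤ x₀ := by nlinarith [hxx₀.le.trans hx₀1]
      calc Q₀ y ≤ wt y * (2 * (xf y ^ 4 * normSqAt G y (hessAt G N y))
            + 8 * (xf y ^ 2 * gradSqAt G xf y * gradSqAt G N y)) :=
            mul_le_mul_of_nonneg_left hb hwt
        _ ≤ wt y * (2 * (xf y ^ 4 * normSqAt G y (hessAt G N y))
            + 8 * (x₀ * gradSqAt G xf y * gradSqAt G N y)) := by
            gcongr wt y * (_ + 8 * ?_)
            rw [mul_assoc, mul_assoc]
            exact mul_le_mul_of_nonneg_right hx2 hg0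
        _ = 2 * H₀ y + 8 * x₀ * I₀ y := by simp only [hH₀def, hI₀def]; ring
    · rw [hQ0 y hy, hI0 y hy, hH0 y hy]; linarith
  -- smoothness on the collar and integrability
  have hwts : ContDiffOn ℝ ∞ wt V' := by
    have h1 : ContDiffOn ℝ ∞ (fun y ↦ (xf y)⁻¹) V' := hxf'.inv hne
    have h2 : ContDiffOn ℝ ∞ (fun y ↦ Real.log (xf y)) V' := hxf'.log hne
    have h : ContDiffOn ℝ ∞ (fun y ↦ -s / xf y + t * Real.log (xf y)) V' := by
      refine ((h1.const_smul (-s)).add (h2.const_smul t)).congr fun y _ ↦ ?_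
      simp only [smul_eq_mul, div_eq_mul_inv, neg_mul]
    exact (contDiffOn_const.mul h).exp
  have hI₀s : ContDiffOn ℝ ∞ I₀ V' :=
    (hwts.mul (hG'.contDiffOn_gradSqAt hxf')).mul (hG'.contDiffOn_gradSqAt hN')
  have hH₀s : ContDiffOn ℝ ∞ H₀ V' :=
    (hwts.mul (hxf'.pow 4)).mul (hG'.contDiffOn_normSqAt (hG'.contDiffOn_hessAt hN'))
  have hQ₀s : ContDiffOn ℝ ∞ Q₀ V' := by
    have hA : ContDiffOn ℝ ∞ (covDAt G U) V' := hG'.contDiffOn_covDAt (hUs.mono hV'V)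
    have heq : Q₀ = fun y ↦ wt y * ∑ i, ∑ j, ginv G b y i j *
        G y (covDAt G U y (b i)) (covDAt G U y (b j)) := by
      funext y
      simp only [hQ₀def]
      rw [mtrAt_eq_sum b]
      simp only [ContinuousLinearMap.bilinearComp_apply]
    rw [heq]
    refine hwts.mul (ContDiffOn.sum fun i _ ↦ ContDiffOn.sum fun j _ ↦ ?_)
    exact (hG'.contDiffOn_ginv b i j).mul
      ((hG'.contDiffOn.clm_apply (hA.clm_apply contDiffOn_const)).clm_apply
        (hA.clm_apply contDiffOn_const))
  have hInt : ∀ {k : E → ℝ}, ContDiffOn ℝ ∞ k V' → (∀ z ∉ tsupport N, k z = 0) →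
      Integrable (fun z ↦ sqrtDetGram G b z * k z) μ := fun hk hk0 ↦
    hG'.integrable_sqrtDetGram_mul_of_subset b μ hpos' hsupp (isClosed_tsupport N) hNV' hk hk0
  have hII := hInt hI₀s hI0
  have hIH := hInt hH₀s hH0
  have hIQ := hInt hQ₀s hQ0
  -- Prop. C.4 for `U`, rewritten
  have hC' : (s ^ 2 - ε) * ∫ y, sqrtDetGram G b y * I₀ y ∂μ ≤ ∫ y, sqrtDetGram G b y * Q₀ y ∂μ := by
    have h1 : ∫ y, sqrtDetGram G b y * (Real.exp (2 * (-s / xf y + t * Real.log (xf y)))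
        * (gradSqAt G xf y / xf y ^ 4) * G y (U y) (U y)) ∂μ = ∫ y, sqrtDetGram G b y * I₀ y ∂μ :=
      integral_congr_ae (Eventually.of_forall fun y ↦ by
        show sqrtDetGram G b y * _ = sqrtDetGram G b y * I₀ y
        rw [← hlhs y])
    rw [← h1]
    exact hC
  -- integrate the pointwise bound
  have hmono : ∫ y, sqrtDetGram G b y * Q₀ y ∂μ ≤
      2 * ∫ y, sqrtDetGram G b y * H₀ y ∂μ + 8 * x₀ * ∫ y, sqrtDetGram G b y * I₀ y ∂μ := by
    rw [← integral_const_mul, ← integral_const_mul, ← integral_add (hIH.const_mul _) (hII.const_mul _)]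
    refine integral_mono hIQ ((hIH.const_mul _).add (hII.const_mul _)) fun y ↦ ?_
    show sqrtDetGram G b y * Q₀ y ≤ 2 * (sqrtDetGram G b y * H₀ y) + 8 * x₀ * (sqrtDetGram G b y * I₀ y)
    have h := mul_le_mul_of_nonneg_left (hrhs y) (Real.sqrt_nonneg (gramMatrix G b y).det)
    calc sqrtDetGram G b y * Q₀ y ≤ sqrtDetGram G b y * (2 * H₀ y + 8 * x₀ * I₀ y) := h
      _ = 2 * (sqrtDetGram G b y * H₀ y) + 8 * x₀ * (sqrtDetGram G b y * I₀ y) := by ring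
  -- absorb `8 x₀ ∫ I₀` (`8 x₀ ≤ (s² − ε)/2`)
  set II : ℝ := ∫ y, sqrtDetGram G b y * I₀ y ∂μ with hIIdef
  set HH : ℝ := ∫ y, sqrtDetGram G b y * H₀ y ∂μ with hHHdef
  have hII0 : 0 ≤ II := by
    refine integral_nonneg fun y ↦ ?_
    show 0 ≤ sqrtDetGram G b y * I₀ y
    by_cases hy : y ∈ tsupport N
    · obtain ⟨hyV, -, -⟩ := hNS hy
      have hi := hG.isInvertible y hyV
      have hgs : ∀ φ : E →L[ℝ] ℝ, 0 ≤ φ (sharpAt G y φ) := by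
        intro φ
        rw [← apply_sharpAt_apply hi φ]
        by_cases hz : sharpAt G y φ = 0
        · simp [hz]
        · exact (hpos y hyV _ hz).le
      refine mul_nonneg (Real.sqrt_nonneg _) (mul_nonneg (mul_nonneg (Real.exp_pos _).le ?_) ?_)
      · rw [gradSqAt_apply]; exact hgs _
      · rw [gradSqAt_apply]; exact hgs _
    · rw [hI0 y hy, mul_zero]
  have hx8 : 8 * x₀ ≤ (s ^ 2 - ε) / 2 := by linarith
  have key : (s ^ 2 - ε) * II ≤ 4 * HH := by
    have h1 : (s ^ 2 - ε) * II ≤ 2 * HH + 8 * x₀ * II := hC'.trans hmono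
    nlinarith [h1, hx8, hII0]
  simpa only [hIIdef, hHHdef, hI₀def, hH₀def, hwtdef, mul_assoc] using key

end Integral

end MetricCoord

end Literature.Geometry.Lorentzian

end
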